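/-
  P4 g17 — THE RIGID-HALF DUTY for `FoolingMeasure` (stmt-PneNP-19727): species-independent NECESSARY CONDITIONS on X1 witnesses,
  kernel facts behind memo BarrierNotesP4g17.md v3 §1 (prior art inside the cell: seat 1 ARC-SANDWICH-r2s1g13 Lemma L / R9, IdeasR2s1g16):

  (A) `dark_of_rigid`      : if every proper 3-colouring of Bob's graph satisfies `P` and no proper 3-colouring of
                             Alice's graph satisfies `P`, the hybrid is dark (not 3-colourable).
  (B) `refutes_of_dark`    : conversely, on the DIAGONAL: if `α ⊔ β` is not 3-colourable and every `P`-colouring is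
                             proper on `β`, then Alice's graph `α` refutes `P` automatically.
  (C) `minEntropy_le_rect` : in the exact vocabulary of `FoolingMeasure`: for a measure `μ` supported on loopless
                             non-3-colourable edge sets, the μ-mass of {S : the proper colourings of S[B] are EXACTLY the
                             P-colourings} is bounded by the mass of ONE dark rectangle `aliceClass B P ×ˢ bobClass B P`.
  (D) `x1_minEntropy`      : hence any μ, B obeying the rectangle clause of X1 with bound `τ` satisfies
                             μ{S : Col₃(S[B]) = P} ≤ τ for EVERY predicate P — the colouring-set of Bob's half must have
                             min-entropy ≥ (n/2)·log₂ n + C·n under every X1 witness ("NO RIGID HALF").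
  (F) `x1_cover`          : COVERING-NUMBER criterion: if supp μ is covered by the rigid-half diagonals of |ι| listed
                             (cut, predicate) templates then 1 ≤ |ι|·τ — no support surgery escapes a small template list.
  (G) `uniqueBobSideMassBound` : seat 1's typed-but-unproved RIGID-HALF DUTY (IdeasR2s1g16 `UniqueBobSideMassBound`, R9-Bob)
                             PROVED from (D): mass of members with a one-box Bob half ≤ 8^{|B|}·δ.  (Prior art acknowledged in §G.)
  (E) `foolingMeasure_noRigidHalf` : (D) applied to the crux `AeaCutRectangles.FoolingMeasure` verbatim.
  NON-application (memo v3 ERRATUM 3): the v2 claim "a half-window of one ruler of a normal t-system is uniquely 3-colourable,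
  so μ_t° dies at cost ≈ 1.79n" is FALSE for real members — `PROP(S[B])` contains the Θ(t·n) planted seam words of the OTHER rulers
  (`NormalCycleSystems.seam_proper`; r2s2g17 §2), whose family has min-entropy ≈ (t−1)(n/2)·log₂ n ≫ purse.  The theorems below are
  necessary conditions the species MEETS at adapted cuts; they kill only supports with a genuinely cheap rigid half.  0 sorry.
-/
import Mathlib
import Summits.PneNP.PneNP.Theses.AeaCutRectangles
import Summits.PneNP.PneNP.Theorems.AeaCutRectanglesDutyRectangles

set_option linter.dupNamespace false

open Finset

namespace Summit.PneNP.PneNP.Cruxes.FoolingMeasure.P4g17RigidHalf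

/-! ## A–B. abstract graphs -/
section Abstract
variable {V : Type*}

/-- `c` is a proper 3-colouring of `G`. -/
def IsProper (G : SimpleGraph V) (c : V → Fin 3) : Prop := ∀ ⦃u v : V⦄, G.Adj u v → c u ≠ c v

theorem colorable_iff_exists_proper (G : SimpleGraph V) : G.Colorable 3 ↔ ∃ c, IsProper G c := by
  constructor
  · rintro ⟨C⟩
    exact ⟨C, fun u v h => C.valid h⟩
  · rintro ⟨c, hc⟩
    exact ⟨SimpleGraph.Coloring.mk c (fun h => hc h)⟩

theorem isProper_sup_iff (α β : SimpleGraph V) (c : V → Fin 3) :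
    IsProper (α ⊔ β) c ↔ IsProper α c ∧ IsProper β c := by
  constructor
  · intro h
    exact ⟨fun u v huv => h (Or.inl huv), fun u v huv => h (Or.inr huv)⟩
  · rintro ⟨ha, hb⟩ u v (h | h)
    · exact ha h
    · exact hb h

/-- **(A) rigid Bob + refuting Alice ⇒ dark.** -/
theorem dark_of_rigid (α β : SimpleGraph V) (P : (V → Fin 3) → Prop)
    (hB : ∀ c, IsProper β c → P c) (hA : ∀ c, IsProper α c → ¬ P c) : ¬ (α ⊔ β).Colorable 3 := by
  rw [colorable_iff_exists_proper]
  rintro ⟨c, hc⟩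
  rw [isProper_sup_iff] at hc
  exact hA c hc.1 (hB c hc.2)

/-- **(B) on the diagonal Alice refutes for free.** If the whole graph is dark and every `P`-colouring is proper on
Bob's part, then no proper colouring of Alice's part satisfies `P`. -/
theorem refutes_of_dark (α β : SimpleGraph V) (P : (V → Fin 3) → Prop)
    (hG : ¬ (α ⊔ β).Colorable 3) (hB : ∀ c, P c → IsProper β c) : ∀ c, IsProper α c → ¬ P c := by
  intro c hα hP
  apply hG
  rw [colorable_iff_exists_proper]
  exact ⟨c, (isProper_sup_iff α β c).2 ⟨hα, hB c hP⟩⟩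

end Abstract

/-! ## C–D. the `FoolingMeasure` vocabulary: edge finsets on `Fin n` -/
section X1
open Classical
variable {n : ℕ}

/-- the graph of an edge set. -/
def gr (S : Finset (Sym2 (Fin n))) : SimpleGraph (Fin n) := SimpleGraph.fromEdgeSet (S : Set (Sym2 (Fin n)))

/-- Bob's part: edges inside `B`. -/
def inner (B : Finset (Fin n)) (S : Finset (Sym2 (Fin n))) : Finset (Sym2 (Fin n)) :=
  S.filter fun e => ∀ v ∈ e, v ∈ B

/-- Alice's part: edges meeting `A = Bᶜ`. -/
def outer (B : Finset (Fin n)) (S : Finset (Sym2 (Fin n))) : Finset (Sym2 (Fin n)) :=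
  S.filter fun e => ∃ v ∈ e, v ∉ B

theorem outer_union_inner (B : Finset (Fin n)) (S : Finset (Sym2 (Fin n))) : outer B S ∪ inner B S = S := by
  ext e
  simp only [outer, inner, mem_union, mem_filter]
  constructor
  · rintro (⟨h, _⟩ | ⟨h, _⟩) <;> exact h
  · intro h
    by_cases hq : ∀ v ∈ e, v ∈ B
    · exact Or.inr ⟨h, hq⟩
    · push Not at hq
      exact Or.inl ⟨h, hq⟩

theorem gr_union_adj (S T : Finset (Sym2 (Fin n))) (u v : Fin n) :
    (gr (S ∪ T)).Adj u v ↔ (gr S ⊔ gr T).Adj u v := by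
  simp [gr, SimpleGraph.fromEdgeSet_adj, and_or_right]

theorem gr_union (S T : Finset (Sym2 (Fin n))) : gr (S ∪ T) = gr S ⊔ gr T := by
  ext u v; exact gr_union_adj S T u v

/-- Bob's class: loopless edge sets inside `B` whose proper 3-colourings are EXACTLY the `P`-colourings. -/
noncomputable def bobClass (B : Finset (Fin n)) (P : (Fin n → Fin 3) → Prop) : Finset (Finset (Sym2 (Fin n))) :=
  univ.filter fun β => (∀ e ∈ β, ¬ e.IsDiag ∧ ∀ v ∈ e, v ∈ B) ∧ ∀ c, IsProper (gr β) c ↔ P c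

/-- Alice's class: loopless edge sets meeting `A` none of whose proper 3-colourings is a `P`-colouring. -/
noncomputable def aliceClass (B : Finset (Fin n)) (P : (Fin n → Fin 3) → Prop) : Finset (Finset (Sym2 (Fin n))) :=
  univ.filter fun α => (∀ e ∈ α, ¬ e.IsDiag ∧ ∃ v ∈ e, v ∉ B) ∧ ∀ c, IsProper (gr α) c → ¬ P c

theorem aliceClass_shape (B : Finset (Fin n)) (P : (Fin n → Fin 3) → Prop) :
    ∀ α ∈ aliceClass B P, ∀ e ∈ α, ¬ e.IsDiag ∧ ∃ v ∈ e, v ∉ B := by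
  intro α hα; exact ((mem_filter.1 hα).2).1

theorem bobClass_shape (B : Finset (Fin n)) (P : (Fin n → Fin 3) → Prop) :
    ∀ β ∈ bobClass B P, ∀ e ∈ β, ¬ e.IsDiag ∧ ∀ v ∈ e, v ∈ B := by
  intro β hβ; exact ((mem_filter.1 hβ).2).1

/-- the rectangle `aliceClass ×ˢ bobClass` is DARK. -/
theorem rect_dark (B : Finset (Fin n)) (P : (Fin n → Fin 3) → Prop) :
    ∀ α ∈ aliceClass B P, ∀ β ∈ bobClass B P, ¬ (gr (α ∪ β)).Colorable 3 := by
  intro α hα β hβ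
  rw [gr_union]
  exact dark_of_rigid (gr α) (gr β) P (fun c hc => (((mem_filter.1 hβ).2).2 c).1 hc) ((mem_filter.1 hα).2).2

/-- the diagonal set: supported systems whose Bob half is `P`-rigid (its proper colourings are exactly the
`P`-colourings). -/
noncomputable def rigidDiag (μ : Finset (Sym2 (Fin n)) → ℝ) (B : Finset (Fin n)) (P : (Fin n → Fin 3) → Prop) :
    Finset (Finset (Sym2 (Fin n))) :=
  univ.filter fun S => μ S ≠ 0 ∧ ∀ c, IsProper (gr (inner B S)) c ↔ P c

/-- **(C) min-entropy ≤ one dark rectangle.** For `μ ≥ 0` supported on loopless non-3-colourable edge sets,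
`μ{S : Col₃(S[B]) = P} ≤ Σ_{(α,β) ∈ aliceClass × bobClass} μ(α ∪ β)`. -/
theorem minEntropy_le_rect (μ : Finset (Sym2 (Fin n)) → ℝ) (hμ : ∀ S, 0 ≤ μ S)
    (hsupp : ∀ S, μ S ≠ 0 → (∀ e ∈ S, ¬ e.IsDiag) ∧ ¬ (gr S).Colorable 3)
    (B : Finset (Fin n)) (P : (Fin n → Fin 3) → Prop) :
    ∑ S ∈ rigidDiag μ B P, μ S ≤ ∑ q ∈ aliceClass B P ×ˢ bobClass B P, μ (q.1 ∪ q.2) := by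
  -- the splitting map
  set f : Finset (Sym2 (Fin n)) → Finset (Sym2 (Fin n)) × Finset (Sym2 (Fin n)) :=
    fun S => (outer B S, inner B S) with hf
  have hinj : Set.InjOn f (rigidDiag μ B P : Set (Finset (Sym2 (Fin n)))) := by
    intro S _ T _ hST
    have h1 : outer B S = outer B T := congrArg Prod.fst hST
    have h2 : inner B S = inner B T := congrArg Prod.snd hST
    rw [← outer_union_inner B S, ← outer_union_inner B T, h1, h2]
  have himg : (rigidDiag μ B P).image f ⊆ aliceClass B P ×ˢ bobClass B P := by
    intro q hq
    obtain ⟨S, hS, rfl⟩ := mem_image.1 hq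
    obtain ⟨hS0, hrig⟩ := (mem_filter.1 hS).2
    obtain ⟨hloop, hdark⟩ := hsupp S hS0
    rw [mem_product]
    refine ⟨mem_filter.2 ⟨mem_univ _, ?_, ?_⟩, mem_filter.2 ⟨mem_univ _, ?_, hrig⟩⟩
    · intro e he
      obtain ⟨heS, hq⟩ := mem_filter.1 he
      exact ⟨hloop e heS, hq⟩
    · -- Alice refutes P for free on the diagonal
      have hG : ¬ (gr (outer B S) ⊔ gr (inner B S)).Colorable 3 := by
        rw [← gr_union, outer_union_inner]; exact hdark
      exact refutes_of_dark _ _ P hG (fun c hc => (hrig c).2 hc)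
    · intro e he
      obtain ⟨heS, hq⟩ := mem_filter.1 he
      exact ⟨hloop e heS, hq⟩
  calc ∑ S ∈ rigidDiag μ B P, μ S
      = ∑ S ∈ rigidDiag μ B P, μ ((f S).1 ∪ (f S).2) := by
        refine sum_congr rfl fun S _ => ?_
        simp only [hf, outer_union_inner]
    _ = ∑ q ∈ (rigidDiag μ B P).image f, μ (q.1 ∪ q.2) := by
        rw [sum_image hinj]
    _ ≤ ∑ q ∈ aliceClass B P ×ˢ bobClass B P, μ (q.1 ∪ q.2) :=
        sum_le_sum_of_subset_of_nonneg himg fun q _ _ => hμ _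

/-- **(D) "NO RIGID HALF" — a necessary condition on every X1 witness.** If `μ` (nonnegative, supported on loopless
non-3-colourable edge sets) satisfies the rectangle clause of `FoolingMeasure` at the cut `B` with bound `τ`, then for
EVERY predicate `P` the μ-mass of the systems whose Bob half `S[B]` has exactly the `P`-colourings is at most `τ`:
the random variable `Col₃(S[B])` has min-entropy at least `-log₂ τ = (n/2)·log₂ n + C·n`. -/
theorem x1_minEntropy (μ : Finset (Sym2 (Fin n)) → ℝ) (hμ : ∀ S, 0 ≤ μ S)
    (hsupp : ∀ S, μ S ≠ 0 → (∀ e ∈ S, ¬ e.IsDiag) ∧ ¬ (gr S).Colorable 3)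
    (B : Finset (Fin n)) (τ : ℝ)
    (hrect : ∀ 𝓐 𝓑 : Finset (Finset (Sym2 (Fin n))),
      (∀ α ∈ 𝓐, ∀ e ∈ α, ¬ e.IsDiag ∧ ∃ v ∈ e, v ∉ B) →
      (∀ β ∈ 𝓑, ∀ e ∈ β, ¬ e.IsDiag ∧ ∀ v ∈ e, v ∈ B) →
      (∀ α ∈ 𝓐, ∀ β ∈ 𝓑, ¬ (gr (α ∪ β)).Colorable 3) →
      ∑ q ∈ 𝓐 ×ˢ 𝓑, μ (q.1 ∪ q.2) ≤ τ)
    (P : (Fin n → Fin 3) → Prop) :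
    ∑ S ∈ rigidDiag μ B P, μ S ≤ τ :=
  (minEntropy_le_rect μ hμ hsupp B P).trans
    (hrect _ _ (aliceClass_shape B P) (bobClass_shape B P) (rect_dark B P))

/-- the support clause of `FoolingMeasure` is literally `hsupp` with `gr` unfolded (sanity restatement). -/
theorem hsupp_of_x1 (μ : Finset (Sym2 (Fin n)) → ℝ)
    (h : ∀ S, μ S ≠ 0 → (∀ e ∈ S, ¬ e.IsDiag) ∧
      ¬ (SimpleGraph.fromEdgeSet (S : Set (Sym2 (Fin n)))).Colorable 3) :
    ∀ S, μ S ≠ 0 → (∀ e ∈ S, ¬ e.IsDiag) ∧ ¬ (gr S).Colorable 3 := h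

/-- a finite sum over a `biUnion` is at most the sum of the sums, for non-negative summands [folklore]. -/
theorem sum_biUnion_le_sum_sum {ι α : Type*} [DecidableEq α] (s : Finset ι) (t : ι → Finset α)
    (f : α → ℝ) (hf : ∀ a, 0 ≤ f a) :
    ∑ a ∈ s.biUnion t, f a ≤ ∑ i ∈ s, ∑ a ∈ t i, f a := by
  classical
  induction s using Finset.induction_on with
  | empty => simp
  | insert i s hi ih =>
    rw [Finset.biUnion_insert, Finset.sum_insert hi]
    have h := Finset.sum_union_inter (s₁ := t i) (s₂ := s.biUnion t) (f := f)
    have h0 : 0 ≤ ∑ a ∈ t i ∩ s.biUnion t, f a := Finset.sum_nonneg fun a _ ↦ hf a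
    linarith

/-- **(F) COVERING-NUMBER KILL CRITERION (species-independent).** If the support of a probability measure `μ` is
COVERED by the rigid-half diagonals of a family of (near-balanced cut, predicate) pairs indexed by a finite type `ι`
— every supported `S` has SOME listed cut `B i` on which its Bob half is `P i`-rigid — then the rectangle clause of
X1 with bound `τ` forces `1 ≤ |ι| · τ`.  Contrapositive: a support whose systems always carry a rigid half drawn from
fewer than `2^{(n/2) log₂ n + C n}` templates is never an X1 witness, whatever the weights (no "support surgery"
can help).  (For frame species NO cheap template family exists at adapted cuts — memo v3 ERRATUM 3; the criterion bites species
with a planted uniquely-colourable half, e.g. lifts of a fixed rigid gadget.) -/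
theorem x1_cover {ι : Type*} [Fintype ι] (μ : Finset (Sym2 (Fin n)) → ℝ) (hμ : ∀ S, 0 ≤ μ S) (h1 : ∑ S, μ S = 1)
    (hsupp : ∀ S, μ S ≠ 0 → (∀ e ∈ S, ¬ e.IsDiag) ∧ ¬ (gr S).Colorable 3)
    (ε : ℝ) (τ : ℝ)
    (hrect : ∀ B : Finset (Fin n), (1 / 2 - ε) * (n : ℝ) ≤ B.card → (B.card : ℝ) ≤ (1 / 2 + ε) * n →
      ∀ 𝓐 𝓑 : Finset (Finset (Sym2 (Fin n))),
      (∀ α ∈ 𝓐, ∀ e ∈ α, ¬ e.IsDiag ∧ ∃ v ∈ e, v ∉ B) →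
      (∀ β ∈ 𝓑, ∀ e ∈ β, ¬ e.IsDiag ∧ ∀ v ∈ e, v ∈ B) →
      (∀ α ∈ 𝓐, ∀ β ∈ 𝓑, ¬ (gr (α ∪ β)).Colorable 3) →
      ∑ q ∈ 𝓐 ×ˢ 𝓑, μ (q.1 ∪ q.2) ≤ τ)
    (Bf : ι → Finset (Fin n)) (Pf : ι → (Fin n → Fin 3) → Prop)
    (hbal : ∀ i, (1 / 2 - ε) * (n : ℝ) ≤ (Bf i).card ∧ ((Bf i).card : ℝ) ≤ (1 / 2 + ε) * n)
    (hcover : ∀ S, μ S ≠ 0 → ∃ i, ∀ c, IsProper (gr (inner (Bf i) S)) c ↔ Pf i c) :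
    (1 : ℝ) ≤ Fintype.card ι * τ := by
  have hτ : ∀ i, ∑ S ∈ rigidDiag μ (Bf i) (Pf i), μ S ≤ τ := fun i =>
    x1_minEntropy μ hμ hsupp (Bf i) τ (hrect (Bf i) (hbal i).1 (hbal i).2) (Pf i)
  -- supported systems lie in the union of the diagonals
  have hsub : (univ.filter fun S => μ S ≠ 0) ⊆ (univ : Finset ι).biUnion fun i => rigidDiag μ (Bf i) (Pf i) := by
    intro S hS
    obtain ⟨i, hi⟩ := hcover S (mem_filter.1 hS).2
    exact mem_biUnion.2 ⟨i, mem_univ _, mem_filter.2 ⟨mem_univ _, (mem_filter.1 hS).2, hi⟩⟩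
  calc (1 : ℝ) = ∑ S, μ S := h1.symm
    _ = ∑ S ∈ univ.filter (fun S => μ S ≠ 0), μ S := by
        rw [sum_filter_ne_zero]
    _ ≤ ∑ S ∈ (univ : Finset ι).biUnion (fun i => rigidDiag μ (Bf i) (Pf i)), μ S :=
        sum_le_sum_of_subset_of_nonneg hsub fun S _ _ => hμ S
    _ ≤ ∑ i, ∑ S ∈ rigidDiag μ (Bf i) (Pf i), μ S := sum_biUnion_le_sum_sum _ _ μ hμ
    _ ≤ ∑ _i : ι, τ := sum_le_sum fun i _ => hτ i
    _ = Fintype.card ι * τ := by simp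


/-- **(E) the crux itself forces NO RIGID HALF.** `FoolingMeasure` unpacked: every witnessing measure gives EVERY
rigid-half diagonal `rigidDiag μ B P` (near-balanced `B`, arbitrary `P`) mass at most `2^{-(n/2) log₂ n - C n}`. -/
theorem foolingMeasure_noRigidHalf (h : Summit.PneNP.PneNP.Theses.AeaCutRectangles.FoolingMeasure) :
    ∃ ε : ℝ, 0 < ε ∧ ε ≤ 1 / 4 ∧ ∀ C : ℕ, ∃ᶠ n in Filter.atTop, ∃ μ : Finset (Sym2 (Fin n)) → ℝ,
      (∀ S, 0 ≤ μ S) ∧ (∑ S, μ S = 1) ∧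
      (∀ S, μ S ≠ 0 → (∀ e ∈ S, ¬ e.IsDiag) ∧ ¬ (gr S).Colorable 3) ∧
      ∀ B : Finset (Fin n), (1 / 2 - ε) * (n : ℝ) ≤ B.card → (B.card : ℝ) ≤ (1 / 2 + ε) * n →
        ∀ P : (Fin n → Fin 3) → Prop,
          ∑ S ∈ rigidDiag μ B P, μ S ≤ (2 : ℝ) ^ (-((n : ℝ) / 2 * Real.logb 2 n) - (C : ℝ) * n) := by
  obtain ⟨ε, hε, hε', hC⟩ := h
  refine ⟨ε, hε, hε', fun C => (hC C).mono ?_⟩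
  rintro n ⟨μ, h0, h1, hs, hB⟩
  refine ⟨μ, h0, h1, hs, fun B hlo hhi P => ?_⟩
  exact x1_minEntropy μ h0 hs B _ (fun 𝓐 𝓑 hA hB' hd => hB B hlo hhi 𝓐 𝓑 hA hB' hd) P


end X1

end Summit.PneNP.PneNP.Cruxes.FoolingMeasure.P4g17RigidHalf

/-! ## (G) Seat 1's typed RIGID-HALF DUTY `UniqueBobSideMassBound` (IdeasR2s1g16; ARC-SANDWICH-r2s1g13 Lemma L / R9 on Bob's side) — PROVED

PRIOR ART INSIDE THE CELL (acknowledged): seat 1 (crux-ideate r2s1) had the necessary condition of this file on ALICE's side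
(Lemma L: `H_∞(EXT_B(α_B(G))) ≥ (n/2)log₂n + Cn`; R9) fifteen hours earlier, with `rigidityRectDark` / `bobSide_kills_extSet`
proved (g16) and the Bob-side mass bound `UniqueBobSideMassBound` TYPED but unproved.  Below it is proved from `x1_minEntropy`:
`rigidMembers μ B` is covered by the `8^{|B|}` diagonals `rigidDiag μ B (InBox B F)`, `F : B → Finset (Fin 3)` (the member whose
Bob half is not 3-colourable sits in the full-palette box; impossible on the empty cut).
BUILD NOTE: the farm snapshot does not build `Cruxes/…` modules as imports (rc 75 `unbuilt`), so seat 1's eight statement-level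
definitions are reproduced VERBATIM in namespace `…P4g17RigidHalf.R2s1g16Copy` (same text as `IdeasR2s1g16` ll. 34–56,
113–127, 190–200); `R2s1g16Copy.UniqueBobSideMassBound` and `IdeasR2s1g16.UniqueBobSideMassBound` are the same term up to the
names of the copies. -/

/-! ## Verbatim copies of seat 1's definitions (IdeasR2s1g16, 2026-08-28) -/
namespace Summit.PneNP.PneNP.Cruxes.FoolingMeasure.P4g17RigidHalf.R2s1g16Copy

open Finset
open Summit.PneNP.PneNP.Theorems.AeaCutRectanglesDutyRectangles

/-- `B` is a near-balanced cut of `Fin n` at tolerance `ε`. -/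
def NearBalanced (ε : ℝ) {n : ℕ} (B : Finset (Fin n)) : Prop :=
  (1 / 2 - ε) * (n : ℝ) ≤ B.card ∧ (B.card : ℝ) ≤ (1 / 2 + ε) * n

/-- X1's mass threshold `2^{-(n/2)·log₂ n − C·n}`. -/
noncomputable def delta (C n : ℕ) : ℝ :=
  (2 : ℝ) ^ (-((n : ℝ) / 2 * Real.logb 2 n) - (C : ℝ) * n)

/-- X1's rectangle clause for a weight `μ` at size `n`, tolerance `ε`, constant `C` (verbatim from the route statement). -/
def RectClause {n : ℕ} (μ : Finset (Sym2 (Fin n)) → ℝ) (ε : ℝ) (C : ℕ) : Prop :=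
  ∀ B : Finset (Fin n), (1 / 2 - ε) * (n : ℝ) ≤ B.card → (B.card : ℝ) ≤ (1 / 2 + ε) * n →
    ∀ 𝓐 𝓑 : Finset (Finset (Sym2 (Fin n))),
      (∀ α ∈ 𝓐, ∀ e ∈ α, ¬ e.IsDiag ∧ ∃ v ∈ e, v ∉ B) →
      (∀ β ∈ 𝓑, ∀ e ∈ β, ¬ e.IsDiag ∧ ∀ v ∈ e, v ∈ B) →
      (∀ α ∈ 𝓐, ∀ β ∈ 𝓑,
        ¬ (SimpleGraph.fromEdgeSet ((α ∪ β : Finset (Sym2 (Fin n))) : Set (Sym2 (Fin n)))).Colorable 3) →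
      ∑ q ∈ 𝓐 ×ˢ 𝓑, μ (q.1 ∪ q.2) ≤ delta C n

/-- A weight is a loopless NON-3-COL probability weight (X1's support conditions). -/
def IsNon3ColWeight {n : ℕ} (μ : Finset (Sym2 (Fin n)) → ℝ) : Prop :=
  (∀ S, 0 ≤ μ S) ∧ (∑ S, μ S = 1) ∧
    ∀ S, μ S ≠ 0 → (∀ e ∈ S, ¬ e.IsDiag) ∧ ¬ (SimpleGraph.fromEdgeSet (S : Set (Sym2 (Fin n)))).Colorable 3

/-- The colour-symmetric PALETTE BOX on `B` with forbidden palettes `F`. -/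
def InBox {n : ℕ} (B : Finset (Fin n)) (F : Fin n → Finset (Fin 3)) (c : Fin n → Fin 3) : Prop :=
  ∃ π : Equiv.Perm (Fin 3), ∀ v ∈ B, π (c v) ∉ F v

/-- BOB-BOX-RIGID at `B` with `L` boxes. -/
def BobBoxRigid {n : ℕ} (L : ℕ) (B : Finset (Fin n)) (G : Finset (Sym2 (Fin n))) : Prop :=
  ∃ 𝓕 : Finset (Fin n → Finset (Fin 3)), 𝓕.card ≤ L ∧
    ∀ c : Fin n → Fin 3, c ∉ killSet (bobSide B G) ↔ ∃ F ∈ 𝓕, InBox B F c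

/-- The members of positive weight whose Bob half at `B` is uniquely 3-colourable (`BobBoxRigid 1`). -/
noncomputable def rigidMembers {n : ℕ} (μ : Finset (Sym2 (Fin n)) → ℝ) (B : Finset (Fin n)) :
    Finset (Finset (Sym2 (Fin n))) := by
  classical exact Finset.univ.filter fun G => μ G ≠ 0 ∧ BobBoxRigid 1 B G

/-- RIGID-HALF DUTY, the `L = 1` instance (R9 on Bob's side, typed by seat 1). -/
def UniqueBobSideMassBound : Prop :=
  ∀ (n : ℕ) (μ : Finset (Sym2 (Fin n)) → ℝ) (ε : ℝ) (C : ℕ), IsNon3ColWeight μ → RectClause μ ε C →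
    ∀ B : Finset (Fin n), NearBalanced ε B →
      (∑ G ∈ rigidMembers μ B, μ G) ≤ (8 : ℝ) ^ B.card * delta C n

end Summit.PneNP.PneNP.Cruxes.FoolingMeasure.P4g17RigidHalf.R2s1g16Copy

namespace Summit.PneNP.PneNP.Cruxes.FoolingMeasure.P4g17RigidHalf

open Finset
open Summit.PneNP.PneNP.Theorems.AeaCutRectanglesDutyRectangles (killSet mem_killSet bobSide mem_bobSide map_mk_isDiag_iff)
open Summit.PneNP.PneNP.Cruxes.FoolingMeasure.P4g17RigidHalf.R2s1g16Copy

section Duty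
open Classical
variable {n : ℕ}

/-- the two cells' Bob sides agree. -/
theorem bobSide_eq_inner (B : Finset (Fin n)) (G : Finset (Sym2 (Fin n))) : bobSide B G = inner B G := by
  ext e; simp only [mem_bobSide, inner, mem_filter]

/-- proper colourings are exactly the non-killing ones. -/
theorem isProper_gr_iff_not_mem_killSet (S : Finset (Sym2 (Fin n))) (c : Fin n → Fin 3) :
    IsProper (gr S) c ↔ c ∉ killSet S := by
  constructor
  · rintro hc ⟨e, he, hd, hm⟩
    induction e using Sym2.ind with
    | h a b =>
      have hab : a ≠ b := fun h => hd (Sym2.mk_isDiag_iff.2 h)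
      exact hc ((SimpleGraph.fromEdgeSet_adj _).2 ⟨mem_coe.2 he, hab⟩) ((map_mk_isDiag_iff c a b).1 hm)
  · intro hc u v huv heq
    obtain ⟨hmem, hne⟩ := (SimpleGraph.fromEdgeSet_adj _).1 huv
    exact hc ⟨s(u, v), mem_coe.1 hmem, fun h => hne (Sym2.mk_isDiag_iff.1 h), (map_mk_isDiag_iff c u v).2 heq⟩

/-- extend a forbidden-palette function on `B` to all of `Fin n` (values off `B` are never read by `InBox B`). -/
def boxExt (B : Finset (Fin n)) (F' : ↥B → Finset (Fin 3)) : Fin n → Finset (Fin 3) :=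
  fun v => if h : v ∈ B then F' ⟨v, h⟩ else ∅

theorem inBox_boxExt_iff (B : Finset (Fin n)) (F : Fin n → Finset (Fin 3)) (c : Fin n → Fin 3) :
    InBox B (boxExt B fun v : ↥B => F v) c ↔ InBox B F c := by
  unfold InBox boxExt
  constructor
  · rintro ⟨π, hπ⟩
    exact ⟨π, fun v hv => by simpa [dif_pos hv] using hπ v hv⟩
  · rintro ⟨π, hπ⟩
    exact ⟨π, fun v hv => by simpa [dif_pos hv] using hπ v hv⟩

/-- the box with a full forbidden palette is empty (on a non-empty cut). -/
theorem not_inBox_full (B : Finset (Fin n)) (hB : B.Nonempty) (c : Fin n → Fin 3) :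
    ¬ InBox B (boxExt B fun _ : ↥B => (univ : Finset (Fin 3))) c := by
  rintro ⟨π, hπ⟩
  obtain ⟨v, hv⟩ := hB
  have := hπ v hv
  simp [boxExt, dif_pos hv] at this

/-- on the empty cut Bob's side is empty, so nothing is killed. -/
theorem not_mem_killSet_bobSide_empty (G : Finset (Sym2 (Fin n))) (c : Fin n → Fin 3) :
    c ∉ killSet (bobSide (∅ : Finset (Fin n)) G) := by
  rintro ⟨e, he, -, -⟩
  induction e using Sym2.ind with
  | h a b => exact absurd ((mem_bobSide.1 he).2 a (Sym2.mem_mk_left a b)) (by simp)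

/-- **Seat 1's typed rigid-half duty, proved.** -/
theorem uniqueBobSideMassBound : UniqueBobSideMassBound := by
  intro n μ ε C hμ hrect B hB
  obtain ⟨h0, _h1, hs⟩ := hμ
  -- one predicate per forbidden-palette function on `B`
  let Pf : (↥B → Finset (Fin 3)) → (Fin n → Fin 3) → Prop := fun F' c => InBox B (boxExt B F') c
  have hτ : ∀ F', ∑ S ∈ rigidDiag μ B (Pf F'), μ S ≤ delta C n := fun F' =>
    x1_minEntropy μ h0 hs B (delta C n) (hrect B hB.1 hB.2) (Pf F')
  -- the rigid members are covered by these diagonals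
  have hcover : rigidMembers μ B ⊆
      (univ : Finset (↥B → Finset (Fin 3))).biUnion fun F' => rigidDiag μ B (Pf F') := by
    intro G hG
    have hG' : μ G ≠ 0 ∧ BobBoxRigid 1 B G := by
      simpa [rigidMembers] using hG
    obtain ⟨hne, 𝓕, hcard, hiff⟩ := hG'
    simp only [mem_biUnion, mem_univ, true_and]
    -- rewrite Bob-properness through the kill set
    have key : ∀ c, IsProper (gr (inner B G)) c ↔ ∃ F ∈ 𝓕, InBox B F c := fun c => by
      rw [isProper_gr_iff_not_mem_killSet, ← bobSide_eq_inner]; exact hiff c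
    rcases 𝓕.eq_empty_or_nonempty with h𝓕 | ⟨F, hF⟩
    · -- no box: Bob's half is not 3-colourable; this is the full-palette box (and impossible on the empty cut)
      rcases B.eq_empty_or_nonempty with hBe | hBne
      · subst hBe
        exact absurd ((hiff fun _ => 0).1 (not_mem_killSet_bobSide_empty G fun _ => 0)) (by simp [h𝓕])
      · refine ⟨fun _ => univ, mem_filter.2 ⟨mem_univ _, hne, fun c => ?_⟩⟩
        rw [key c]
        simp only [h𝓕, Finset.notMem_empty, false_and, exists_false, false_iff]
        exact not_inBox_full B hBne c
    · -- one box `F`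
      have hall : ∀ F₂ ∈ 𝓕, F₂ = F := fun F₂ h₂ => Finset.card_le_one.1 hcard F₂ h₂ F hF
      refine ⟨fun v : ↥B => F v, mem_filter.2 ⟨mem_univ _, hne, fun c => ?_⟩⟩
      rw [key c]
      show (∃ F₂ ∈ 𝓕, InBox B F₂ c) ↔ InBox B (boxExt B fun v : ↥B => F v) c
      rw [inBox_boxExt_iff]
      exact ⟨fun ⟨F₂, h₂, hc⟩ => hall F₂ h₂ ▸ hc, fun hc => ⟨F, hF, hc⟩⟩
  have hcardι : Fintype.card (↥B → Finset (Fin 3)) = 8 ^ B.card := by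
    rw [Fintype.card_fun, Fintype.card_finset, Fintype.card_fin, Fintype.card_coe]; norm_num
  calc ∑ G ∈ rigidMembers μ B, μ G
      ≤ ∑ G ∈ (univ : Finset (↥B → Finset (Fin 3))).biUnion (fun F' => rigidDiag μ B (Pf F')), μ G :=
        sum_le_sum_of_subset_of_nonneg hcover fun G _ _ => h0 G
    _ ≤ ∑ F' : (↥B → Finset (Fin 3)), ∑ G ∈ rigidDiag μ B (Pf F'), μ G := sum_biUnion_le_sum_sum _ _ μ h0
    _ ≤ ∑ _F' : (↥B → Finset (Fin 3)), delta C n := sum_le_sum fun F' _ => hτ F'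
    _ = 8 ^ B.card * delta C n := by rw [sum_const, card_univ, hcardι, nsmul_eq_mul]; push_cast; ring

end Duty

end Summit.PneNP.PneNP.Cruxes.FoolingMeasure.P4g17RigidHalf

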